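import Summits.QuantumFields.YangMills.Theorems.UnitScaleTiltFluctuationComparisonRegPrIntLT8OfHalvingExist
import Summits.QuantumFields.YangMills.Theorems.UnitScaleTiltMinimiserStabilityRegPrOfHalvingExistence
import Summits.QuantumFields.YangMills.Theorems.UnitScaleTiltHistoryTailOneSupplierKinematic
import Summits.QuantumFields.YangMills.Theorems.AlphaInputsT3ACv3RecordXChi
import Summits.QuantumFields.YangMills.Theses.UnitScaleTilt
import HarnessLib

/-!
# `UnitScaleTiltYM3OfFiveInputs` — THE RUNG-LEVEL END-TO-END CERTIFICATE UNDER THE SKELETONS OF RECORD v10 ∕ v5kC ∕ v5p9: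
# the route leaf `YM3TorusSU2` (continuum SU(2) Yang–Mills on every 3-torus, cell `ym3-torus` = YM ladder rung R3) FROM FIVE DISPLAYED INPUTS, BY NAME
# (route `route-QuantumFields-UnitScaleTilt` rev 14, `Theses.UnitScaleTilt.closes (h200 : MinimiserStabilityRegPr) (h201 : FluctuationComparisonRegPrIntL) (hK2 : HistoryTailL)`;
# width seat ym-ust-20520-w3 g2 on the deciding crux stmt-QuantumFields-20520; count-neutral, `--supports stmt-QuantumFields-20520 --as helper`)

Under OWNER RULING g24-№5 (2026-08-28T01:11Z) the 19200 skeleton of record is the two-stub v10 {`stub_halvingStep`, `stub_existenceMinimalOrbit`}; the deciding crux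
20520 carries v5kC {2′χ, 3⁗χ, (i*)χ, T8} (STUB 1 credited p591578) and 19936 carries v5p9 {2′χ}.  The width seats have reduced every registered row BY NAME to displayed inputs:
* 19200: `AttainmentOfExistence.MinimiserStabilityRegPr_of_halvingStep_of_existence` (ym-ust-20520-w4 g0, p592478) — the route decl ⇐ ⟨H⟩ ∧ ⟨EX⟩;
* T8: `AttainmentOfExistence.thm1In8GlobalMin_of_halvingStep_of_existence` (w4) — ⟨H⟩ → ⟨EX⟩ → ⟨T8⟩;
* 2′χ: `HistoryTailOneSupplier.pinnedPartsT3ACRecFLChi_of_thm1_kinematicLift_dataRows` (ym-ust-19936-w5 g0, p592351) ∘ `alphaInputsT3ACv3RecChi_of_pinnedPartsRecFLChi` (★alpha-1) —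
  (T) `Thm1GlobalMinAt` ∧ ONE record-free kinematic lift theorem KIN(F, K, B_K, η) ∧ the (O″χ) rows ⟹ `AlphaInputsT3ACv3RecChi L`;
* 20520: `IntLT8OfHalvingExist.regPrIntL_of_halving_exist_recChi_k1aLegRowsDisplayChi_allL` (this seat, p592464) — ⟨H⟩ → ⟨EX⟩ → 2′χ → (K1a per-run display ∀ odd `L > 1`) ⟹ crux;
* 19936: `HistoryTailOneSupplier.historyTailL_of_thm1In8_kinematicLift_dataRows_allL` (w5) — ⟨T8⟩ → KIN → (O″χ) ⟹ `HistoryTailL`.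
Composing them with the route's deciding theorem gives ONE kernel-checked sentence (the cell's DEPMAP under №5, no binder touched):

  **`ym3TorusSU2_of_fiveInputs` : ⟨v10 `stub_halvingStep`⟩ → ⟨v10 `stub_existenceMinimalOrbit`⟩ → (∀ odd L > 1, KIN) → (∀ odd L > 1, the (O″χ) rows) →
  (∀ odd L > 1, ∀ 𝔠 a₀ a₁ …, ∃ a ∈ (0,1), `K1aLegRowsDisplayChi L 𝔠 a₀ a₁ a`) → `T3YM3TorusStatement.YM3TorusSU2`**,

and the twin `ym3TorusSU2_of_fiveInputs_legRows` with ★r1's leg predicate `K1aLegRowsRChi` in place of ym-ust-20520-w1's seven-row display.  The variational input of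
[Balaban1985Variational] enters TWICE — as 19200's own content and T8, and as the (T) row of the χ-record — and both times from {H, EX} alone (Prop. 7's uniqueness clause,
[Balaban1985RegularSpaces] Thm 2, Props 5–6, (141)–(142) are not on the path: w2-19200 FINDING #4 ∕ w4-20520 FINDING w4-1).

WHAT THE FIVE INPUTS ARE (informal; each is the analytic content of a lane and NONE is asserted here): (1) H = [Balaban1985Variational] Sect. F one-step halving for R2-critical
configurations (p.304; XL; 19200 W-seats); (2) EX = Prop. 7's existence clause from a (14)-background, reading R1 (p.299; routes (α) chart∕contraction or (β) closed-fibre direct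
method + INTERIOR; 19200-w4, 20520-w4); (3) KIN = the exact k-fold block-average LIFT with fine plaquettes `< B_K·ε·L^{−2k}` on block-saturated regions ([Balaban1985Variational] (8)
existence clause specialised, free boundary; 19936 W-seats ∕ ★alpha-2, Newton on the (LL) engine); (4) (O″χ) = NODE O's χ-record data rows `DataRowsT3XChi` over the trivial-history
minimiser rows ([Balaban1985UV3] (41)–(42), (47), (68), Thm 2; ★alpha-1); (5) K1a = the per-run kernel∕configuration display behind King's two-run slack ([King1986] Thm 3.4 (3.9),
Prop. 3.6; [Balaban1985UV3] (43)–(46), (57); NODE-O depth, ym-ust-20520-w1 memo `WHAT-3CHI-IS-PER-RUN-w1g0-v3.md`).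

HONEST FRAMING: a composition of landed theorems; no stub, crux or count moves; the five hypotheses are exactly as open as before.  Cell `ym3-torus` (HUMAN RULING D-0037):
YM₃ on T³ is ladder rung R3 — NOT the Clay Millennium problem, not d = 4, not infinite volume, not a mass gap.

References: T. Bałaban, CMP 102 (1985) 277–309 [Balaban1985Variational] (Thm 1 (6)–(8) pp.278–279, (14) p.280, Prop. 7 p.299, Sect. F p.300, Prop. 8 p.304); CMP 102 (1985)
255–275 [Balaban1985UV3] ((7) p.257, (41)–(47) pp.266–267, (57) p.270, (68) p.273, Thm 2 p.272); C. King, CMP 102 (1986) 649–677 [King1986] (Thm 3.4 (3.9) p.656, (3.12) p.657,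
Prop. 3.6 (3.56) p.662); T. Bałaban, CMP 109 (1987) 249–301 [Balaban1987RG1] ((0.4) p.253).
-/

set_option autoImplicit false

noncomputable section

namespace Summit.QuantumFields.YangMills.Theorems.YM3OfFiveInputs

open MeasureTheory Set
open scoped Matrix.Norms.L2Operator
open Literature.MathematicalPhysics.QuantumFieldTheory.Balaban1983to89
open Literature.MathematicalPhysics.QuantumFieldTheory.Balaban1983to89.T3ContinuumYM3Torus
open Literature.MathematicalPhysics.QuantumFieldTheory.Balaban1983to89.T3UnitLawDensityEML (ℰp)
open Literature.MathematicalPhysics.QuantumFieldTheory.Balaban1983to89.T3PrintedRegularMinimiser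
open Literature.MathematicalPhysics.QuantumFieldTheory.Balaban1983to89.T3PrintedMinimiserExistence (Thm1GlobalMinAt)
open Literature.MathematicalPhysics.QuantumFieldTheory.Balaban1983to89.T3LowerAlongMinimisersSplit (MinimisersIn8At)
open Literature.MathematicalPhysics.QuantumFieldTheory.Balaban1983to89.T3ConstrainedMinimiser (fibre)
open Literature.MathematicalPhysics.QuantumFieldTheory.Balaban1983to89.T3Thm1Carrier (famX Idx)
open Literature.MathematicalPhysics.QuantumFieldTheory.Balaban1983to89.ExpMeanLog (deltaSU)
open Literature.MathematicalPhysics.QuantumFieldTheory.Balaban1983to89.B10Eq38TorusDomains (plaqsIn toFine)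
open Literature.MathematicalPhysics.QuantumFieldTheory.Balaban1983to89.B10Eq42TorusConstraint (bondsIn)
open Literature.MathematicalPhysics.QuantumFieldTheory.Balaban1985CMP102.Setting
open Summit.QuantumFields.Balaban3D.Carriers
open Summit.QuantumFields.Balaban3D.Proofs.Primitives
open Summit.QuantumFields.Balaban3D.Proofs.Thresholds (Q0)
open B7Prop2Explicit (C0)
open Summit.QuantumFields.YangMills.Theorems.GlobalSlackKernelLeg (K1aLegRowsRChi K1aLegRowsDisplayChi)

/-- **2′χ AT ONE ODD BLOCK SIZE FROM {H, EX}, THE KINEMATIC LIFT AND THE (O″χ) ROWS** — the χ-record `AlphaInputsT3ACv3RecChi L` of the deciding crux ∕ of `HistoryTailL`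
with its (T) row fed by T8 ⇐ {H, EX} (ym-ust-20520-w4's `thm1In8GlobalMin_of_halvingStep_of_existence`), its (FL) row by the record-free kinematic lift theorem and its data rows
by the (O″χ) supplier (ym-ust-19936-w5's `pinnedPartsT3ACRecFLChi_of_thm1_kinematicLift_dataRows`, ★alpha-1's `alphaInputsT3ACv3RecChi_of_pinnedPartsRecFLChi`).
[cite: Balaban1985Variational, Thm 1 (6)-(8) pp.278-279, Prop. 7 p.299, Prop. 8 p.304; Balaban1985UV3, (7) p.257, (41)-(42) p.266, (47) p.267, Thm 2 p.272] -/
theorem recChi_of_halving_exist_kinematicLift_dataRows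
    (hH : ∀ (L : ℕ), 1 < L → ∃ B₃ : ℝ, 4 < B₃ ∧ ∃ a₅ : ℝ, 0 < a₅ ∧
      ∀ (i : Idx L) (ε₀ ε₁ : ℝ), 0 < ε₁ → ∀ (V : (famX L i).Bdry) (U : (famX L i).Cfg), (famX L i).Reg7 ε₁ V → (famX L i).InU ε₀ U →
        (famX L i).InB V U → (famX L i).IsCritical V U → ε₀ ≤ a₅ → (famX L i).InU (max (B₃ * ε₁) (ε₀ / 2)) U)
    (hEX : ∀ (L : ℕ), 1 < L → ∀ (B₃ : ℝ), 4 < B₃ → ∃ a₁' O₁ : ℝ, 0 < a₁' ∧ 1 ≤ O₁ ∧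
      ∀ (F : T3Family), F.L = L → ∀ (n K : ℕ) (hnK : n < K) (ε₁ : ℝ), 0 < ε₁ →
        ∀ V : GaugeField (F.P n) 0 (Matrix.specialUnitaryGroup (Fin 2) ℂ), PlaqSmall ε₁ V →
          ∀ U₀ : GaugeField (F.P K) 0 (Matrix.specialUnitaryGroup (Fin 2) ℂ), RegPr F n K ((L : ℝ) ^ 3 * B₃ * ε₁) U₀ → U₀ ∈ fibre F ℰp n K hnK.le V →
            ε₁ ≤ a₁' → ∃ U ∈ regFibrePr F n K hnK.le (O₁ * (L : ℝ) ^ 3 * B₃ * ε₁) V,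
              IsMinOn (fun W : GaugeField (F.P K) 0 (Matrix.specialUnitaryGroup (Fin 2) ℂ) => wilsonAction4 W)
                (regFibrePr F n K hnK.le (O₁ * (L : ℝ) ^ 3 * B₃ * ε₁) V) U)
    (hkin : ∀ L : ℕ, Odd L → 1 < L → ∃ (B_K η : ℝ), 0 < η ∧
      ∀ (F : T3Family) (_hF : F.L = L) (K : ℕ), ∀ (k : ℕ), k ≤ K → ∀ (Ω : Set (Site (F.P K) 0)), (∀ w : Site (F.P K) 0, w ∈ Ω ↔ toFine k (coarsen k w) ∈ Ω) →
        ∀ (ε : ℝ), 0 < ε → ε ≤ η → ∀ (W : GaugeField (F.P K) k (Matrix.specialUnitaryGroup (Fin 2) ℂ)), PlaqSmallOn (↑(plaqsIn k Ω)) ε W →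
          ∃ U : GaugeField (F.P K) 0 (Matrix.specialUnitaryGroup (Fin 2) ℂ),
            (∀ b : PBond (F.P K) k, b ∈ bondsIn k Ω → Averaging.iter (fun i => BlockAveraging.blockAvg (P := F.P K) (j := i) ℰp) k U b = W b) ∧
            ∀ q : Plaq (F.P K) 0, q ∈ plaqsIn 0 Ω → GaugeGroup.dist1 (GaugeField.plaqHol U q) < B_K * ε * (((F.L : ℝ) ^ k)⁻¹) ^ 2)
    (hO : ∀ L : ℕ, Odd L → 1 < L → ∃ (B₀ A₀ A₁ : ℝ), 0 < A₀ ∧ 0 < A₁ ∧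
      ∀ (B a₀ a₁ : ℝ), B₀ ≤ B → 1 ≤ 2 * B → 0 < a₀ → a₀ ≤ A₀ → 0 < a₁ → a₁ ≤ A₁ → B * a₁ ≤ a₀ →
        (143 * ((((3 + 4 : ℕ) : ℝ)) ^ 2 / 4) ^ 2) * (2 * (B * a₁)) ≤ 1 / 3 →
        2 * (2 * (B * a₁)) ≤ 2 * deltaSU (Fin 2) / (((3 + 4) * L : ℕ) : ℝ) ^ 2 →
        Thm1GlobalMinAt L a₀ a₁ B →
        ∃ (b₁ p₁ : ℝ), ∀ (b₀ p₀ : ℝ), b₁ ≤ b₀ → p₁ ≤ p₀ →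
          ∃ 𝔠 : AlphaConsts L (suGroupModel 2).N, 𝔠.b₀ = b₀ ∧ 𝔠.p₀ = p₀ ∧ 𝔠.B₃ = B ∧
            4 * 𝔠.B₃ * (L : ℝ) ^ 2 * avgWindowFactor L ≤ 𝔠.C68 ∧
            Real.exp (𝔠.p₀ - 1) ≤ 3 * C0 3 * 𝔠.C68 * (𝔠.b₀ * Q0 𝔠.p₀) ∧
            (𝔠.b₀ * Q0 𝔠.p₀) * (2 * (L : ℝ) ^ 2 * avgWindowFactor L) ^ 2 ≤ 3 * C0 3 * 𝔠.C68 * a₁ ^ 2 ∧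
            7 * L + 3 ≤ 𝔠.M₁ ∧
            ∀ (F : T3Family) (hF : F.L = L),
              (∀ (γ : ℝ) (hγ : 0 < γ) (hγ1 : γ ≤ (min (hF ▸ 𝔠).gamma0 1) ^ 2) (K : ℕ),
                (∃ Ut : (k : ℕ) → GaugeField (F.P K) k (Matrix.specialUnitaryGroup (Fin 2) ℂ) →
                    GaugeField (F.P K) 0 (Matrix.specialUnitaryGroup (Fin 2) ℂ),
                  AlphaInputsT3AC.TrivMinimiserRowsT3 F (hF ▸ 𝔠) γ hγ hγ1 a₀ a₁ K Ut) →
                ∃ Ut : (k : ℕ) → GaugeField (F.P K) k (Matrix.specialUnitaryGroup (Fin 2) ℂ) →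
                    GaugeField (F.P K) 0 (Matrix.specialUnitaryGroup (Fin 2) ℂ),
                  AlphaInputsT3AC.TrivMinimiserRowsT3 F (hF ▸ 𝔠) γ hγ hγ1 a₀ a₁ K Ut ∧
                    AlphaInputsT3AC.DataRowsT3XChi F (hF ▸ 𝔠) γ hγ hγ1 K Ut)) :
    ∀ L : ℕ, Odd L → 1 < L → AlphaInputsT3ACv3RecChi L := by
  intro L hLo hL
  obtain ⟨a₀, a₁, B₃, ha₀, ha₁, hB₃, hT, -⟩ := AttainmentOfExistence.thm1In8GlobalMin_of_halvingStep_of_existence hH hEX L hLo hL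
  obtain ⟨B_K, η, hη, hk⟩ := hkin L hLo hL
  obtain ⟨B₀, A₀, A₁, hA₀, hA₁, hO'⟩ := hO L hLo hL
  exact alphaInputsT3ACv3RecChi_of_pinnedPartsRecFLChi
    (HistoryTailOneSupplier.pinnedPartsT3ACRecFLChi_of_thm1_kinematicLift_dataRows hL ⟨a₀, a₁, B₃, ha₀, ha₁, hB₃, hT⟩ hη hk hA₀ hA₁ hO')

/-- ★★★ **THE RUNG FROM FIVE DISPLAYED INPUTS** — `YM3TorusSU2` (continuum SU(2) Yang–Mills on every 3-torus, the route leaf of `route-QuantumFields-UnitScaleTilt`) from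
⟨v10 `stub_halvingStep`⟩, ⟨v10 `stub_existenceMinimalOrbit`⟩, the kinematic lift ∀ odd `L > 1`, the (O″χ) rows ∀ odd `L > 1`, and ym-ust-20520-w1's per-run K1a display
∀ odd `L > 1` — through `Theses.UnitScaleTilt.closes` with h200 := w4's `MinimiserStabilityRegPr_of_halvingStep_of_existence`, h201 := this seat's
`regPrIntL_of_halving_exist_recChi_k1aLegRowsDisplayChi_allL` (2′χ by `recChi_of_halving_exist_kinematicLift_dataRows`), hK2 := w5-19936's
`historyTailL_of_thm1In8_kinematicLift_dataRows_allL`.  Nothing is asserted; the five hypotheses are the open analytic content of the cell.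
[cite: Balaban1985Variational, Thm 1 (8) p.279, Prop. 7 p.299, Sect. F p.300, Prop. 8 p.304; Balaban1985UV3, (41)-(47) pp.266-267, (57) p.270, Thm 2 p.272; King1986, Thm 3.4 (3.9) p.656, Prop. 3.6 (3.56) p.662; Balaban1987RG1, (0.4) p.253] -/
theorem ym3TorusSU2_of_fiveInputs
    (hH : ∀ (L : ℕ), 1 < L → ∃ B₃ : ℝ, 4 < B₃ ∧ ∃ a₅ : ℝ, 0 < a₅ ∧
      ∀ (i : Idx L) (ε₀ ε₁ : ℝ), 0 < ε₁ → ∀ (V : (famX L i).Bdry) (U : (famX L i).Cfg), (famX L i).Reg7 ε₁ V → (famX L i).InU ε₀ U →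
        (famX L i).InB V U → (famX L i).IsCritical V U → ε₀ ≤ a₅ → (famX L i).InU (max (B₃ * ε₁) (ε₀ / 2)) U)
    (hEX : ∀ (L : ℕ), 1 < L → ∀ (B₃ : ℝ), 4 < B₃ → ∃ a₁' O₁ : ℝ, 0 < a₁' ∧ 1 ≤ O₁ ∧
      ∀ (F : T3Family), F.L = L → ∀ (n K : ℕ) (hnK : n < K) (ε₁ : ℝ), 0 < ε₁ →
        ∀ V : GaugeField (F.P n) 0 (Matrix.specialUnitaryGroup (Fin 2) ℂ), PlaqSmall ε₁ V →
          ∀ U₀ : GaugeField (F.P K) 0 (Matrix.specialUnitaryGroup (Fin 2) ℂ), RegPr F n K ((L : ℝ) ^ 3 * B₃ * ε₁) U₀ → U₀ ∈ fibre F ℰp n K hnK.le V →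
            ε₁ ≤ a₁' → ∃ U ∈ regFibrePr F n K hnK.le (O₁ * (L : ℝ) ^ 3 * B₃ * ε₁) V,
              IsMinOn (fun W : GaugeField (F.P K) 0 (Matrix.specialUnitaryGroup (Fin 2) ℂ) => wilsonAction4 W)
                (regFibrePr F n K hnK.le (O₁ * (L : ℝ) ^ 3 * B₃ * ε₁) V) U)
    (hkin : ∀ L : ℕ, Odd L → 1 < L → ∃ (B_K η : ℝ), 0 < η ∧
      ∀ (F : T3Family) (_hF : F.L = L) (K : ℕ), ∀ (k : ℕ), k ≤ K → ∀ (Ω : Set (Site (F.P K) 0)), (∀ w : Site (F.P K) 0, w ∈ Ω ↔ toFine k (coarsen k w) ∈ Ω) →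
        ∀ (ε : ℝ), 0 < ε → ε ≤ η → ∀ (W : GaugeField (F.P K) k (Matrix.specialUnitaryGroup (Fin 2) ℂ)), PlaqSmallOn (↑(plaqsIn k Ω)) ε W →
          ∃ U : GaugeField (F.P K) 0 (Matrix.specialUnitaryGroup (Fin 2) ℂ),
            (∀ b : PBond (F.P K) k, b ∈ bondsIn k Ω → Averaging.iter (fun i => BlockAveraging.blockAvg (P := F.P K) (j := i) ℰp) k U b = W b) ∧
            ∀ q : Plaq (F.P K) 0, q ∈ plaqsIn 0 Ω → GaugeGroup.dist1 (GaugeField.plaqHol U q) < B_K * ε * (((F.L : ℝ) ^ k)⁻¹) ^ 2)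
    (hO : ∀ L : ℕ, Odd L → 1 < L → ∃ (B₀ A₀ A₁ : ℝ), 0 < A₀ ∧ 0 < A₁ ∧
      ∀ (B a₀ a₁ : ℝ), B₀ ≤ B → 1 ≤ 2 * B → 0 < a₀ → a₀ ≤ A₀ → 0 < a₁ → a₁ ≤ A₁ → B * a₁ ≤ a₀ →
        (143 * ((((3 + 4 : ℕ) : ℝ)) ^ 2 / 4) ^ 2) * (2 * (B * a₁)) ≤ 1 / 3 →
        2 * (2 * (B * a₁)) ≤ 2 * deltaSU (Fin 2) / (((3 + 4) * L : ℕ) : ℝ) ^ 2 →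
        Thm1GlobalMinAt L a₀ a₁ B →
        ∃ (b₁ p₁ : ℝ), ∀ (b₀ p₀ : ℝ), b₁ ≤ b₀ → p₁ ≤ p₀ →
          ∃ 𝔠 : AlphaConsts L (suGroupModel 2).N, 𝔠.b₀ = b₀ ∧ 𝔠.p₀ = p₀ ∧ 𝔠.B₃ = B ∧
            4 * 𝔠.B₃ * (L : ℝ) ^ 2 * avgWindowFactor L ≤ 𝔠.C68 ∧
            Real.exp (𝔠.p₀ - 1) ≤ 3 * C0 3 * 𝔠.C68 * (𝔠.b₀ * Q0 𝔠.p₀) ∧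
            (𝔠.b₀ * Q0 𝔠.p₀) * (2 * (L : ℝ) ^ 2 * avgWindowFactor L) ^ 2 ≤ 3 * C0 3 * 𝔠.C68 * a₁ ^ 2 ∧
            7 * L + 3 ≤ 𝔠.M₁ ∧
            ∀ (F : T3Family) (hF : F.L = L),
              (∀ (γ : ℝ) (hγ : 0 < γ) (hγ1 : γ ≤ (min (hF ▸ 𝔠).gamma0 1) ^ 2) (K : ℕ),
                (∃ Ut : (k : ℕ) → GaugeField (F.P K) k (Matrix.specialUnitaryGroup (Fin 2) ℂ) →
                    GaugeField (F.P K) 0 (Matrix.specialUnitaryGroup (Fin 2) ℂ),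
                  AlphaInputsT3AC.TrivMinimiserRowsT3 F (hF ▸ 𝔠) γ hγ hγ1 a₀ a₁ K Ut) →
                ∃ Ut : (k : ℕ) → GaugeField (F.P K) k (Matrix.specialUnitaryGroup (Fin 2) ℂ) →
                    GaugeField (F.P K) 0 (Matrix.specialUnitaryGroup (Fin 2) ℂ),
                  AlphaInputsT3AC.TrivMinimiserRowsT3 F (hF ▸ 𝔠) γ hγ hγ1 a₀ a₁ K Ut ∧
                    AlphaInputsT3AC.DataRowsT3XChi F (hF ▸ 𝔠) γ hγ hγ1 K Ut))
    (hDisp : ∀ (L : ℕ), Odd L → 1 < L → ∀ (𝔠 : AlphaConsts L (suGroupModel 2).N) (a₀ a₁ : ℝ), 0 < a₀ → 0 < a₁ → 𝔠.B₃ * a₁ ≤ a₀ →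
      ∃ a : ℝ, 0 < a ∧ a < 1 ∧ K1aLegRowsDisplayChi L 𝔠 a₀ a₁ a) :
    Literature.MathematicalPhysics.QuantumFieldTheory.Balaban1983to89.T3YM3TorusStatement.YM3TorusSU2 :=
  have hT8 := AttainmentOfExistence.thm1In8GlobalMin_of_halvingStep_of_existence hH hEX
  Summit.QuantumFields.YangMills.Theses.UnitScaleTilt.closes
    (AttainmentOfExistence.MinimiserStabilityRegPr_of_halvingStep_of_existence hH hEX)
    (IntLT8OfHalvingExist.regPrIntL_of_halving_exist_recChi_k1aLegRowsDisplayChi_allL hH hEX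
      (recChi_of_halving_exist_kinematicLift_dataRows hH hEX hkin hO) hDisp)
    (HistoryTailOneSupplier.historyTailL_of_thm1In8_kinematicLift_dataRows_allL hT8 hkin hO)

/-- ★★★ **THE SAME WITH ★r1's LEG PREDICATE `K1aLegRowsRChi`** (five leg rows at the χ-record's canonical datum) in place of the seven-row display.
[cite: Balaban1985Variational, Thm 1 (8) p.279, Prop. 8 p.304; Balaban1985UV3, (43)-(47) pp.266-267; King1986, Thm 3.4 (3.9) p.656] -/
theorem ym3TorusSU2_of_fiveInputs_legRows
    (hH : ∀ (L : ℕ), 1 < L → ∃ B₃ : ℝ, 4 < B₃ ∧ ∃ a₅ : ℝ, 0 < a₅ ∧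
      ∀ (i : Idx L) (ε₀ ε₁ : ℝ), 0 < ε₁ → ∀ (V : (famX L i).Bdry) (U : (famX L i).Cfg), (famX L i).Reg7 ε₁ V → (famX L i).InU ε₀ U →
        (famX L i).InB V U → (famX L i).IsCritical V U → ε₀ ≤ a₅ → (famX L i).InU (max (B₃ * ε₁) (ε₀ / 2)) U)
    (hEX : ∀ (L : ℕ), 1 < L → ∀ (B₃ : ℝ), 4 < B₃ → ∃ a₁' O₁ : ℝ, 0 < a₁' ∧ 1 ≤ O₁ ∧
      ∀ (F : T3Family), F.L = L → ∀ (n K : ℕ) (hnK : n < K) (ε₁ : ℝ), 0 < ε₁ →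
        ∀ V : GaugeField (F.P n) 0 (Matrix.specialUnitaryGroup (Fin 2) ℂ), PlaqSmall ε₁ V →
          ∀ U₀ : GaugeField (F.P K) 0 (Matrix.specialUnitaryGroup (Fin 2) ℂ), RegPr F n K ((L : ℝ) ^ 3 * B₃ * ε₁) U₀ → U₀ ∈ fibre F ℰp n K hnK.le V →
            ε₁ ≤ a₁' → ∃ U ∈ regFibrePr F n K hnK.le (O₁ * (L : ℝ) ^ 3 * B₃ * ε₁) V,
              IsMinOn (fun W : GaugeField (F.P K) 0 (Matrix.specialUnitaryGroup (Fin 2) ℂ) => wilsonAction4 W)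
                (regFibrePr F n K hnK.le (O₁ * (L : ℝ) ^ 3 * B₃ * ε₁) V) U)
    (hkin : ∀ L : ℕ, Odd L → 1 < L → ∃ (B_K η : ℝ), 0 < η ∧
      ∀ (F : T3Family) (_hF : F.L = L) (K : ℕ), ∀ (k : ℕ), k ≤ K → ∀ (Ω : Set (Site (F.P K) 0)), (∀ w : Site (F.P K) 0, w ∈ Ω ↔ toFine k (coarsen k w) ∈ Ω) →
        ∀ (ε : ℝ), 0 < ε → ε ≤ η → ∀ (W : GaugeField (F.P K) k (Matrix.specialUnitaryGroup (Fin 2) ℂ)), PlaqSmallOn (↑(plaqsIn k Ω)) ε W →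
          ∃ U : GaugeField (F.P K) 0 (Matrix.specialUnitaryGroup (Fin 2) ℂ),
            (∀ b : PBond (F.P K) k, b ∈ bondsIn k Ω → Averaging.iter (fun i => BlockAveraging.blockAvg (P := F.P K) (j := i) ℰp) k U b = W b) ∧
            ∀ q : Plaq (F.P K) 0, q ∈ plaqsIn 0 Ω → GaugeGroup.dist1 (GaugeField.plaqHol U q) < B_K * ε * (((F.L : ℝ) ^ k)⁻¹) ^ 2)
    (hO : ∀ L : ℕ, Odd L → 1 < L → ∃ (B₀ A₀ A₁ : ℝ), 0 < A₀ ∧ 0 < A₁ ∧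
      ∀ (B a₀ a₁ : ℝ), B₀ ≤ B → 1 ≤ 2 * B → 0 < a₀ → a₀ ≤ A₀ → 0 < a₁ → a₁ ≤ A₁ → B * a₁ ≤ a₀ →
        (143 * ((((3 + 4 : ℕ) : ℝ)) ^ 2 / 4) ^ 2) * (2 * (B * a₁)) ≤ 1 / 3 →
        2 * (2 * (B * a₁)) ≤ 2 * deltaSU (Fin 2) / (((3 + 4) * L : ℕ) : ℝ) ^ 2 →
        Thm1GlobalMinAt L a₀ a₁ B →
        ∃ (b₁ p₁ : ℝ), ∀ (b₀ p₀ : ℝ), b₁ ≤ b₀ → p₁ ≤ p₀ →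
          ∃ 𝔠 : AlphaConsts L (suGroupModel 2).N, 𝔠.b₀ = b₀ ∧ 𝔠.p₀ = p₀ ∧ 𝔠.B₃ = B ∧
            4 * 𝔠.B₃ * (L : ℝ) ^ 2 * avgWindowFactor L ≤ 𝔠.C68 ∧
            Real.exp (𝔠.p₀ - 1) ≤ 3 * C0 3 * 𝔠.C68 * (𝔠.b₀ * Q0 𝔠.p₀) ∧
            (𝔠.b₀ * Q0 𝔠.p₀) * (2 * (L : ℝ) ^ 2 * avgWindowFactor L) ^ 2 ≤ 3 * C0 3 * 𝔠.C68 * a₁ ^ 2 ∧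
            7 * L + 3 ≤ 𝔠.M₁ ∧
            ∀ (F : T3Family) (hF : F.L = L),
              (∀ (γ : ℝ) (hγ : 0 < γ) (hγ1 : γ ≤ (min (hF ▸ 𝔠).gamma0 1) ^ 2) (K : ℕ),
                (∃ Ut : (k : ℕ) → GaugeField (F.P K) k (Matrix.specialUnitaryGroup (Fin 2) ℂ) →
                    GaugeField (F.P K) 0 (Matrix.specialUnitaryGroup (Fin 2) ℂ),
                  AlphaInputsT3AC.TrivMinimiserRowsT3 F (hF ▸ 𝔠) γ hγ hγ1 a₀ a₁ K Ut) →
                ∃ Ut : (k : ℕ) → GaugeField (F.P K) k (Matrix.specialUnitaryGroup (Fin 2) ℂ) →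
                    GaugeField (F.P K) 0 (Matrix.specialUnitaryGroup (Fin 2) ℂ),
                  AlphaInputsT3AC.TrivMinimiserRowsT3 F (hF ▸ 𝔠) γ hγ hγ1 a₀ a₁ K Ut ∧
                    AlphaInputsT3AC.DataRowsT3XChi F (hF ▸ 𝔠) γ hγ hγ1 K Ut))
    (hK : ∀ (L : ℕ), Odd L → 1 < L → ∀ (𝔠 : AlphaConsts L (suGroupModel 2).N) (a₀ a₁ : ℝ), 0 < a₀ → 0 < a₁ → 𝔠.B₃ * a₁ ≤ a₀ →
      ∃ a : ℝ, 0 < a ∧ a < 1 ∧ K1aLegRowsRChi L 𝔠 a₀ a₁ a) :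
    Literature.MathematicalPhysics.QuantumFieldTheory.Balaban1983to89.T3YM3TorusStatement.YM3TorusSU2 :=
  have hT8 := AttainmentOfExistence.thm1In8GlobalMin_of_halvingStep_of_existence hH hEX
  Summit.QuantumFields.YangMills.Theses.UnitScaleTilt.closes
    (AttainmentOfExistence.MinimiserStabilityRegPr_of_halvingStep_of_existence hH hEX)
    (IntLT8OfHalvingExist.regPrIntL_of_halving_exist_recChi_k1aLegRowsRChi_allL hH hEX
      (recChi_of_halving_exist_kinematicLift_dataRows hH hEX hkin hO) hK)
    (HistoryTailOneSupplier.historyTailL_of_thm1In8_kinematicLift_dataRows_allL hT8 hkin hO)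

end Summit.QuantumFields.YangMills.Theorems.YM3OfFiveInputs

end
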